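import Literature.Topology.FourManifolds.NearIdentityIsotopy
import Literature.Topology.FourManifolds.IsotopyProofs
import Mathlib.LinearAlgebra.FiniteDimensional.Lemmas
import HarnessLib

/-!
# Realising a germ of diffeomorphism by a compactly supported ambient isotopy that preserves a
# linear subspace

Topic `Literature/Topology/FourManifolds` (fact seat
`provefact-Literature.Topology.FourManifolds.Cobord-7d2044dc04`, tenure on
`Literature.Topology.FourManifolds.Cobordism.Milnor1965_cancellation_levelIsotopy`; first file
of a proof of Milnor's local **Theorem 5.6** of *Lectures on the h-cobordism theorem* (1965),
the named fact `Literature.Topology.FourManifolds.Milnor1965_localIsotopy` of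
`HCobordismLocalIsotopy.lean`, on which the general case of Assertion 6 of the proof of the
First Cancellation Theorem 5.4 rests).  Everything here is **proved**; no named facts.

The device of this file replaces Milnor's Lemma 5.9 and the iteration of PDF pp. 34–36 (which
control the new intersections of `h_t(Rᵃ)` with `Rᵇ` created by an isotopy) by isotopies that
create no new intersection *by construction*, because all their stages preserve a linear
subspace, or move points only parallel to one.  The isotopies are composites of the
straight-line perturbation isotopies `y ↦ y + λ(t) χ(y) g(y)` of the tree
(`Literature.Topology.FourManifolds.perturbationIsotopy`, `NearIdentityIsotopy.lean`; Hirsch,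
*Differential Topology* (1976), Ch. 8 §1 and §3, proof of Thm. 3.1), whose displacement at `y`
is a scalar multiple of `g(y)`: so a stage maps a submodule `S` into itself as soon as `g`
does, and displaces points inside a submodule `K` as soon as `g` takes values in `K`.

## Contents (all proved)

* `exists_perturbation_smul_of_norm_fderiv_le` — the cut-off lemma of `NearIdentityIsotopy.lean`
  (`p = χ(·/r) • g` is smooth, `‖Dp‖ ≤ 1/2`, `p = g` on `B̄(0, r)`, `p = 0` off `B(0, 2r)`) with
  the scalar structure `p y = c • g y` recorded;
* `exists_ambientIsotopy_realising_linear` — for continuous linear maps `M₁, …, M_m` with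
  `‖Mᵢ - 1‖ ≤ ε₀` and a radius `r`, an ambient isotopy of `E`, supported in `B(0, 2r)`, whose
  time-one map is `M_m ∘ ⋯ ∘ M₁` on `B̄(0, r / 2^m)`, all of whose stages fix `0`, preserve any
  submodule `S` preserved by the `Mᵢ` and displace inside any submodule `K` containing the
  ranges of the `Mᵢ - 1`;
* `exists_ambientIsotopy_realising_germ` — **realisation of a germ**: for `Θ` smooth near `0`
  with `Θ 0 = 0` and `DΘ(0) = M_m ∘ ⋯ ∘ M₁` as above, and any `ρ > 0`, an ambient isotopy of `E`
  supported in `B(0, ρ)` whose time-one map agrees with `Θ` near `0`, with the same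
  preservation properties (given that `Θ` has them near `0`).

## References

* M. W. Hirsch, *Differential Topology*, GTM 33 (1976), Ch. 8 §1 (p. 178, diffeotopies with
  compact support), §3 (proof of Thm. 3.1: isotoping an embedding to its linear part and the
  linear part to the identity through near-identity steps). [HirschDT1976]
* J. Milnor, *Lectures on the h-cobordism theorem* (1965), Thm. 5.6 (PDF p. 32) — the consumer.
  [MilnorHCobordism1965]
-/

open scoped Manifold ContDiff Topology
open Function Set Filter Metric

noncomputable section

namespace Literature.Topology.FourManifolds

/-! ### The cut-off lemma with the scalar structure of the perturbation recorded -/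

/-- **Cut-off lemma, scalar form.**  There is `ε₀ > 0` (depending only on `E`) such that: for
every `r > 0` and every `g : E → E`, `C^∞` on an open `V ⊇ B̄(0, 2r)` with `g 0 = 0` and
`‖Dg‖ ≤ ε₀` on `B̄(0, 2r)`, there is a smooth `p : E → E` with `‖Dp‖ ≤ 1/2` everywhere, `p = g`
on `B̄(0, r)`, `p = 0` off `B(0, 2r)`, and `p y` a scalar multiple of `g y` for every `y`
(indeed `p = χ(·/r) • g` for a fixed bump `χ`).  Same proof as
`Literature.Topology.FourManifolds.exists_perturbation_of_norm_fderiv_le`, which does not record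
the last property. [cite: HirschDT1976, Ch. 8 §3, proof of Thm. 3.1] -/
theorem exists_perturbation_smul_of_norm_fderiv_le (E : Type*) [NormedAddCommGroup E]
    [NormedSpace ℝ E] [FiniteDimensional ℝ E] [CompleteSpace E] :
    ∃ ε₀ > (0 : ℝ), ∀ r > (0 : ℝ), ∀ (g : E → E) (V : Set E), IsOpen V →
      closedBall (0 : E) (2 * r) ⊆ V → ContDiffOn ℝ ∞ g V → g 0 = 0 →
      (∀ z ∈ closedBall (0 : E) (2 * r), ‖fderiv ℝ g z‖ ≤ ε₀) →
      ∃ p : E → E, ContDiff ℝ ∞ p ∧ (∀ y, ‖fderiv ℝ p y‖ ≤ 1 / 2) ∧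
        (∀ y ∈ closedBall (0 : E) r, p y = g y) ∧ (∀ y, 2 * r ≤ ‖y‖ → p y = 0) ∧
        ∀ y, ∃ c : ℝ, p y = c • g y := by
  -- a fixed bump function and a bound for its derivative
  let χ : ContDiffBump (0 : E) := ⟨1, 2, one_pos, by norm_num⟩
  have hχc : ContDiff ℝ ∞ χ := χ.contDiff
  obtain ⟨C₀, hC₀⟩ := (χ.hasCompactSupport.fderiv ℝ).exists_bound_of_continuous
    (hχc.continuous_fderiv (by simp))
  set C : ℝ := max C₀ 0 with hC
  have hC0 : 0 ≤ C := le_max_right _ _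
  have hCb : ∀ z, ‖fderiv ℝ χ z‖ ≤ C := fun z ↦ (hC₀ z).trans (le_max_left _ _)
  refine ⟨1 / (2 * (1 + 2 * C)), by positivity, ?_⟩
  intro r hr g V hVo hVB hg hg0 hgb
  set ε₀ : ℝ := 1 / (2 * (1 + 2 * C)) with hε₀
  have hε₀0 : 0 < ε₀ := by positivity
  -- the rescaled bump `χr y = χ (y / r)`
  set χr : E → ℝ := fun y ↦ χ (r⁻¹ • y) with hχr
  have hχr_smooth : ContDiff ℝ ∞ χr := hχc.comp (contDiff_const_smul r⁻¹)
  have hχr_one : ∀ y ∈ closedBall (0 : E) r, χr y = 1 := by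
    intro y hy
    apply χ.one_of_mem_closedBall
    simp only [mem_closedBall, dist_zero_right, norm_smul, norm_inv, Real.norm_eq_abs,
      abs_of_pos hr] at hy ⊢
    rw [inv_mul_le_iff₀ hr]
    show ‖y‖ ≤ r * 1
    simpa using hy
  have hχr_zero : ∀ y, 2 * r ≤ ‖y‖ → χr y = 0 := by
    intro y hy
    apply χ.zero_of_le_dist
    simp only [dist_zero_right, norm_smul, norm_inv, Real.norm_eq_abs, abs_of_pos hr]
    rw [le_inv_mul_iff₀ hr]
    show r * 2 ≤ ‖y‖
    linarith
  have hχr_le : ∀ y, |χr y| ≤ 1 := fun y ↦ by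
    rw [abs_of_nonneg (χ.nonneg' _)]
    exact χ.le_one
  have hχr_fderiv : ∀ y, ‖fderiv ℝ χr y‖ ≤ C / r := by
    intro y
    have h1 : HasFDerivAt χr ((fderiv ℝ χ (r⁻¹ • y)).comp (r⁻¹ • ContinuousLinearMap.id ℝ E)) y := by
      have hd : HasFDerivAt χ (fderiv ℝ χ (r⁻¹ • y)) (r⁻¹ • y) :=
        (hχc.differentiable (by simp) _).hasFDerivAt
      have hl : HasFDerivAt (fun y : E ↦ r⁻¹ • y) (r⁻¹ • ContinuousLinearMap.id ℝ E) y :=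
        (hasFDerivAt_id y).const_smul r⁻¹
      exact hd.comp y hl
    rw [h1.fderiv]
    calc ‖(fderiv ℝ χ (r⁻¹ • y)).comp (r⁻¹ • ContinuousLinearMap.id ℝ E)‖
        ≤ ‖fderiv ℝ χ (r⁻¹ • y)‖ * ‖r⁻¹ • ContinuousLinearMap.id ℝ E‖ :=
          ContinuousLinearMap.opNorm_comp_le _ _
      _ ≤ C * r⁻¹ := by
          gcongr
          · exact hCb _
          · rw [norm_smul, norm_inv, Real.norm_eq_abs, abs_of_pos hr]
            simpa using mul_le_of_le_one_right (inv_nonneg.mpr hr.le)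
              (ContinuousLinearMap.norm_id_le (𝕜 := ℝ) (E := E))
      _ = C / r := by rw [div_eq_mul_inv]
  have hχr_ev : ∀ y, 2 * r < ‖y‖ → χr =ᶠ[𝓝 y] fun _ ↦ 0 := by
    intro y hy
    have ho : IsOpen {z : E | 2 * r < ‖z‖} := isOpen_lt continuous_const continuous_norm
    filter_upwards [ho.mem_nhds hy] with z hz
    exact hχr_zero z (le_of_lt hz)
  -- the perturbation `p = χr • g`
  set φ : E → E := fun y ↦ χr y • g y with hφ
  have hgd : ∀ z ∈ V, DifferentiableAt ℝ g z := fun z hz ↦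
    (hg.contDiffAt (hVo.mem_nhds hz)).differentiableAt (by simp)
  have hg_bound : ∀ y ∈ closedBall (0 : E) (2 * r), ‖g y‖ ≤ ε₀ * ‖y‖ := by
    intro y hy
    have := (convex_closedBall (0 : E) (2 * r)).norm_image_sub_le_of_norm_fderiv_le
      (fun z hz ↦ hgd z (hVB hz)) hgb (mem_closedBall_self (by positivity)) hy
    simpa [hg0] using this
  have hφ_smooth : ContDiff ℝ ∞ φ := by
    rw [contDiff_iff_contDiffAt]
    intro y
    by_cases hy : y ∈ V
    · exact hχr_smooth.contDiffAt.smul (hg.contDiffAt (hVo.mem_nhds hy))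
    · have hy2 : 2 * r < ‖y‖ := by
        by_contra h'
        exact hy (hVB (by simpa using not_lt.mp h'))
      refine (contDiffAt_const (c := (0 : E))).congr_of_eventuallyEq ?_
      filter_upwards [hχr_ev y hy2] with z hz
      simp [hφ, hz]
  have hφ_zero : ∀ y, 2 * r ≤ ‖y‖ → φ y = 0 := fun y hy ↦ by simp [hφ, hχr_zero y hy]
  have hφ_fderiv : ∀ y, ‖fderiv ℝ φ y‖ ≤ 1 / 2 := by
    intro y
    rcases le_or_gt ‖y‖ (2 * r) with hy | hy
    · have hyB : y ∈ closedBall (0 : E) (2 * r) := by simpa using hy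
      have hyV : y ∈ V := hVB hyB
      have hd : HasFDerivAt φ (χr y • fderiv ℝ g y + (fderiv ℝ χr y).smulRight (g y)) y :=
        (hχr_smooth.differentiable (by simp) y).hasFDerivAt.smul (hgd y hyV).hasFDerivAt
      rw [hd.fderiv]
      calc ‖χr y • fderiv ℝ g y + (fderiv ℝ χr y).smulRight (g y)‖
          ≤ ‖χr y • fderiv ℝ g y‖ + ‖(fderiv ℝ χr y).smulRight (g y)‖ := norm_add_le _ _
        _ = |χr y| * ‖fderiv ℝ g y‖ + ‖fderiv ℝ χr y‖ * ‖g y‖ := by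
            rw [norm_smul, Real.norm_eq_abs, ContinuousLinearMap.norm_smulRight_apply]
        _ ≤ 1 * ε₀ + C / r * (ε₀ * ‖y‖) := by
            gcongr
            · exact hχr_le y
            · exact hgb y hyB
            · exact hχr_fderiv y
            · exact hg_bound y hyB
        _ ≤ 1 * ε₀ + C / r * (ε₀ * (2 * r)) := by gcongr
        _ = ε₀ * (1 + 2 * C) := by field_simp
        _ = 1 / 2 := by rw [hε₀]; field_simp
    · have : fderiv ℝ φ y = 0 := by
        have hev : φ =ᶠ[𝓝 y] fun _ ↦ 0 := by
          filter_upwards [hχr_ev y hy] with z hz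
          simp [hφ, hz]
        rw [hev.fderiv_eq, fderiv_const_apply]
      rw [this, norm_zero]
      norm_num
  refine ⟨φ, hφ_smooth, hφ_fderiv, fun y hy => ?_, hφ_zero, fun y => ⟨χr y, rfl⟩⟩
  simp [hφ, hχr_one y hy]

/-! ### One perturbation step -/

section Step

variable {E : Type*} [NormedAddCommGroup E] [NormedSpace ℝ E] [CompleteSpace E]

/-- **One step**: the straight-line isotopy `y ↦ y + λ(t) p(y)` of a perturbation `p` with
`‖Dp‖ ≤ 1/2` and `p y ∈ ℝ g(y)`, `p = g` on `B̄(0, r)`, `p = 0` off `B(0, 2r)`, is an ambient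
isotopy of `E` supported in `B(0, 2r)` with time-one map `y ↦ y + g y` on `B̄(0, r)`; its stages
fix `0` if `g 0 = 0`, map a submodule `S` into itself wherever `g` does, and displace points by
elements of a submodule `K` wherever `g` takes values in `K`. [cite: HirschDT1976, Ch. 8 §1, p. 178] -/
theorem exists_ambientIsotopy_step {p g : E → E} (hp : ContDiff ℝ ∞ p)
    (hb : ∀ y, ‖fderiv ℝ p y‖ ≤ 1 / 2) {r : ℝ} (hpg : ∀ y ∈ closedBall (0 : E) r, p y = g y)
    (hp0 : ∀ y, 2 * r ≤ ‖y‖ → p y = 0) (hsmul : ∀ y, ∃ c : ℝ, p y = c • g y) (hg0 : g 0 = 0) :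
    ∃ F : AmbientIsotopy 𝓘(ℝ, E) E,
      (∀ t y, 2 * r ≤ ‖y‖ → F.toFun t y = y) ∧
      (∀ y, ‖y‖ ≤ r → F.toFun 1 y = y + g y) ∧
      (∀ (S : Submodule ℝ E) t y, y ∈ S → g y ∈ S → F.toFun t y ∈ S) ∧
      (∀ (K : Submodule ℝ E) t y, g y ∈ K → F.toFun t y - y ∈ K) ∧
      (∀ t, F.toFun t 0 = 0) := by
  refine ⟨perturbationIsotopy hp hb, fun t y hy => ?_, fun y hy => ?_, fun S t y hy hgy => ?_,
    fun K t y hgy => ?_, fun t => ?_⟩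
  · simp [perturbationStage, hp0 y hy]
  · rw [perturbationIsotopy_toFun, perturbationStage,
      Real.smoothTransition.one_of_one_le le_rfl, one_smul, hpg y (by simpa using hy)]
  · rw [perturbationIsotopy_toFun, perturbationStage]
    obtain ⟨c, hc⟩ := hsmul y
    rw [hc]
    exact S.add_mem hy (S.smul_mem _ (S.smul_mem _ hgy))
  · rw [perturbationIsotopy_toFun, perturbationStage, add_sub_cancel_left]
    obtain ⟨c, hc⟩ := hsmul y
    rw [hc]
    exact K.smul_mem _ (K.smul_mem _ hgy)
  · rw [perturbationIsotopy_toFun, perturbationStage]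
    obtain ⟨c, hc⟩ := hsmul 0
    rw [hc, hg0, smul_zero, smul_zero, add_zero]

end Step

/-! ### Realising a product of near-identity linear maps -/

section Linear

variable {E : Type*} [NormedAddCommGroup E] [NormedSpace ℝ E] [FiniteDimensional ℝ E]
  [CompleteSpace E]

omit [FiniteDimensional ℝ E] [CompleteSpace E] in
/-- The norm of a product of continuous linear maps of norm `≤ 2` applied to `y` is at most
`2 ^ m ‖y‖`. [folklore] -/
theorem norm_list_prod_apply_le {Ms : List (E →L[ℝ] E)} (hM : ∀ M ∈ Ms, ‖M‖ ≤ 2) (y : E) :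
    ‖Ms.prod y‖ ≤ 2 ^ Ms.length * ‖y‖ := by
  induction Ms with
  | nil => simp
  | cons M Ms ih =>
    rw [List.prod_cons, mul_apply_eq_comp, List.length_cons, pow_succ]
    have hM2 : ‖M‖ ≤ 2 := hM M (by simp)
    have ih' := ih fun N hN => hM N (by simp [hN])
    calc ‖M (Ms.prod y)‖ ≤ ‖M‖ * ‖Ms.prod y‖ := M.le_opNorm _
      _ ≤ 2 * (2 ^ Ms.length * ‖y‖) := by
          gcongr
      _ = 2 ^ Ms.length * 2 * ‖y‖ := by ring

/-- **Realising a product of near-identity linear maps by a compactly supported ambient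
isotopy.**  There is `ε₀ ∈ (0, 1]` (depending only on `E`) such that for all continuous linear
maps `M₁, …, M_m` of `E` with `‖Mᵢ - 1‖ ≤ ε₀` (listed as `[M_m, …, M₁]`) and every `r > 0` there
is an ambient isotopy `F` of `E`, all of whose stages are the identity off `B(0, 2r)` and fix
`0`, with `F₁ = M_m ∘ ⋯ ∘ M₁` on `B̄(0, r / 2^m)`; moreover every stage maps a submodule `S`
into itself if all `Mᵢ` do, and `F_t y - y` lies in a submodule `K` for all `t, y` if all
`Mᵢ - 1` take values in `K`.  (Composite of the straight-line isotopies of the cut-off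
perturbations `χ • (Mᵢ - 1)`; Hirsch (1976), Ch. 8 §3, proof of Thm. 3.1, the step "`GL⁺(n)` is
connected" made by near-identity steps.) [cite: HirschDT1976, Ch. 8 §3, proof of Thm. 3.1] -/
theorem exists_ambientIsotopy_realising_linear (E : Type*) [NormedAddCommGroup E]
    [NormedSpace ℝ E] [FiniteDimensional ℝ E] [CompleteSpace E] :
    ∃ ε₀ ∈ Ioc (0 : ℝ) 1, ∀ (S K : Submodule ℝ E) (Ms : List (E →L[ℝ] E)) (r : ℝ), 0 < r →
      (∀ M ∈ Ms, ‖M - 1‖ ≤ ε₀) → (∀ M ∈ Ms, ∀ y ∈ S, M y ∈ S) →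
      (∀ M ∈ Ms, ∀ y, M y - y ∈ K) →
      ∃ F : AmbientIsotopy 𝓘(ℝ, E) E,
        (∀ t y, 2 * r ≤ ‖y‖ → F.toFun t y = y) ∧
        (∀ y, ‖y‖ ≤ r / 2 ^ Ms.length → F.toFun 1 y = Ms.prod y) ∧
        (∀ t, ∀ y ∈ S, F.toFun t y ∈ S) ∧ (∀ t y, F.toFun t y - y ∈ K) ∧
        (∀ t, F.toFun t 0 = 0) := by
  obtain ⟨ε₀, hε₀, H⟩ := exists_perturbation_smul_of_norm_fderiv_le E
  refine ⟨min ε₀ 1, ⟨lt_min hε₀ one_pos, min_le_right _ _⟩, ?_⟩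
  intro S K Ms r hr hM hMS hMK
  induction Ms with
  | nil =>
    refine ⟨AmbientIsotopy.refl, fun t y _ => rfl, fun y _ => by simp, fun t y hy => hy,
      fun t y => by simp, fun t => rfl⟩
  | cons M Ms ih =>
    obtain ⟨F, hFsupp, hF1, hFS, hFK, hF0⟩ := ih (fun N hN => hM N (by simp [hN]))
      (fun N hN => hMS N (by simp [hN])) (fun N hN => hMK N (by simp [hN]))
    -- the perturbation step for `M`
    set g : E → E := fun y => M y - y with hg
    have hgs : ContDiffOn ℝ ∞ g univ := (M.contDiff.sub contDiff_id).contDiffOn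
    have hgd : ∀ z, fderiv ℝ g z = M - 1 := fun z =>
      (M.hasFDerivAt.sub (hasFDerivAt_id z)).fderiv
    obtain ⟨p, hp, hb, hpg, hp0, hsmul⟩ := H r hr g univ isOpen_univ (subset_univ _) hgs
      (by simp [hg]) fun z _ => by rw [hgd]; exact (hM M (by simp)).trans (min_le_left _ _)
    obtain ⟨G, hGsupp, hG1, hGS, hGK, hG0⟩ :=
      exists_ambientIsotopy_step hp hb hpg hp0 hsmul (by simp [hg])
    refine ⟨F.comp G, fun t y hy => ?_, fun y hy => ?_, fun t y hy => ?_, fun t y => ?_,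
      fun t => ?_⟩
    · rw [AmbientIsotopy.comp_toFun, comp_apply, hFsupp t y hy, hGsupp t y hy]
    · have hlen : (2 : ℝ) ^ (M :: Ms).length = 2 ^ Ms.length * 2 := by
        rw [List.length_cons, pow_succ]
      have hy' : ‖y‖ ≤ r / 2 ^ Ms.length := by
        refine hy.trans ?_
        rw [hlen]
        exact div_le_div_of_nonneg_left hr.le (by positivity) (by nlinarith [pow_pos (two_pos (α := ℝ)) Ms.length])
      have hM2 : ∀ N ∈ Ms, ‖N‖ ≤ 2 := by
        intro N hN
        have h1 : ‖N - 1‖ ≤ 1 := (hM N (by simp [hN])).trans (min_le_right _ _)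
        calc ‖N‖ = ‖(N - 1) + 1‖ := by rw [sub_add_cancel]
          _ ≤ ‖N - 1‖ + ‖(1 : E →L[ℝ] E)‖ := norm_add_le _ _
          _ ≤ 1 + 1 := add_le_add h1 ContinuousLinearMap.norm_id_le
          _ = 2 := by norm_num
      have hnorm : ‖Ms.prod y‖ ≤ r := by
        calc ‖Ms.prod y‖ ≤ 2 ^ Ms.length * ‖y‖ := norm_list_prod_apply_le hM2 y
          _ ≤ 2 ^ Ms.length * (r / 2 ^ Ms.length) := by gcongr
          _ = r := by field_simp
      have key : G.toFun 1 (Ms.prod y) = M (Ms.prod y) := by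
        rw [hG1 _ hnorm, hg]
        exact add_sub_cancel _ _
      rw [AmbientIsotopy.comp_toFun, comp_apply, hF1 y hy', key, List.prod_cons,
        mul_apply_eq_comp]
    · rw [AmbientIsotopy.comp_toFun, comp_apply]
      exact hGS S t _ (hFS t y hy) (by
        rw [hg]; exact S.sub_mem (hMS M (by simp) _ (hFS t y hy)) (hFS t y hy))
    · rw [AmbientIsotopy.comp_toFun, comp_apply]
      have h1 := hGK K t (F.toFun t y) (hMK M (by simp) _)
      have h2 := hFK t y
      have : G.toFun t (F.toFun t y) - y = (G.toFun t (F.toFun t y) - F.toFun t y) +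
          (F.toFun t y - y) := by abel
      rw [this]
      exact K.add_mem h1 h2
    · rw [AmbientIsotopy.comp_toFun, comp_apply, hF0 t, hG0 t]

end Linear

/-! ### Invariant submodules and inverses -/

section Invariant

variable {E : Type*} [NormedAddCommGroup E] [NormedSpace ℝ E]

/-- If a continuous linear automorphism displaces every point inside a submodule `K`
(`M y - y ∈ K`), so does its inverse. [folklore] -/
theorem ContinuousLinearEquiv.symm_apply_sub_mem {K : Submodule ℝ E} (M : E ≃L[ℝ] E)
    (hM : ∀ y, M y - y ∈ K) (y : E) : M.symm y - y ∈ K := by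
  have h := hM (M.symm y)
  rw [M.apply_symm_apply] at h
  have : M.symm y - y = -(y - M.symm y) := by abel
  rw [this]
  exact K.neg_mem h

/-- The same for a product of automorphisms. [folklore] -/
theorem list_prod_symm_apply_sub_mem {K : Submodule ℝ E} (Ms : List (E ≃L[ℝ] E))
    (hM : ∀ M ∈ Ms, ∀ y, M y - y ∈ K) (y : E) : (Ms.prod).symm y - y ∈ K := by
  induction Ms generalizing y with
  | nil =>
    rw [List.prod_nil]
    change y - y ∈ K
    rw [sub_self]
    exact K.zero_mem
  | cons M Ms ih =>
    rw [List.prod_cons]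
    change (Ms.prod).symm (M.symm y) - y ∈ K
    have h1 := ih (fun N hN => hM N (by simp [hN])) (M.symm y)
    have h2 := ContinuousLinearEquiv.symm_apply_sub_mem M (hM M (by simp)) y
    have : (Ms.prod).symm (M.symm y) - y =
        ((Ms.prod).symm (M.symm y) - M.symm y) + (M.symm y - y) := by abel
    rw [this]
    exact K.add_mem h1 h2

variable [FiniteDimensional ℝ E]

/-- In finite dimension, a linear automorphism mapping a submodule into itself maps it onto
itself, so its inverse also preserves it. [folklore] -/
theorem ContinuousLinearEquiv.symm_apply_mem_of_forall_apply_mem {S : Submodule ℝ E}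
    (M : E ≃L[ℝ] E) (hM : ∀ y ∈ S, M y ∈ S) {y : E} (hy : y ∈ S) : M.symm y ∈ S := by
  -- the restriction of `M` to `S` is an injective endomorphism of `S`, hence surjective
  set f : S →ₗ[ℝ] S := (M.toLinearEquiv.toLinearMap.restrict fun s hs => hM s hs) with hf
  have hinj : Function.Injective f := by
    intro s s' h
    apply Subtype.ext
    have : (f s : E) = f s' := by rw [h]
    simpa [hf] using this
  obtain ⟨s, hs⟩ := (LinearMap.injective_iff_surjective.1 hinj) ⟨y, hy⟩
  have hs' : M s = y := by
    have := congrArg Subtype.val hs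
    simpa [hf] using this
  rw [← hs', M.symm_apply_apply]
  exact s.2

/-- The same for a product of automorphisms. [folklore] -/
theorem list_prod_symm_apply_mem {S : Submodule ℝ E} (Ms : List (E ≃L[ℝ] E))
    (hM : ∀ M ∈ Ms, ∀ y ∈ S, M y ∈ S) {y : E} (hy : y ∈ S) : (Ms.prod).symm y ∈ S := by
  induction Ms generalizing y with
  | nil =>
    rw [List.prod_nil]
    exact hy
  | cons M Ms ih =>
    rw [List.prod_cons]
    change (Ms.prod).symm (M.symm y) ∈ S
    exact ih (fun N hN => hM N (by simp [hN]))
      (ContinuousLinearEquiv.symm_apply_mem_of_forall_apply_mem M (hM M (by simp)) hy)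

end Invariant

/-! ### Realising a germ -/

section Germ

variable {E : Type*} [NormedAddCommGroup E] [NormedSpace ℝ E] [FiniteDimensional ℝ E]
  [CompleteSpace E]

omit [FiniteDimensional ℝ E] [CompleteSpace E] in
/-- The product of a list of automorphisms, as a continuous linear map, is the product of the
underlying continuous linear maps. [folklore] -/
theorem coe_list_prod (Ms : List (E ≃L[ℝ] E)) :
    ((Ms.prod : E ≃L[ℝ] E) : E →L[ℝ] E) = (Ms.map ContinuousLinearEquiv.toContinuousLinearMap).prod := by
  induction Ms with
  | nil => rfl
  | cons M Ms ih => rw [List.prod_cons, List.map_cons, List.prod_cons, ← ih]; rfl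

/-- **Realising a germ by a compactly supported ambient isotopy preserving a subspace.**
There is `ε₀ ∈ (0, 1]` (depending only on `E`) such that: let `Θ` be `C^∞` on an open `O ∋ 0`
with `Θ 0 = 0`, whose derivative at `0` is a product `M_m ∘ ⋯ ∘ M₁` of automorphisms with
`‖Mᵢ - 1‖ ≤ ε₀`; let `S`, `K` be submodules such that `Θ` and the `Mᵢ` map `S` into `S` and
`Θ - id`, `Mᵢ - 1` take values in `K` (on `O`); and let `ρ > 0`.  Then there is an ambient
isotopy `F` of `E`, all of whose stages are the identity off `B(0, ρ)`, fix `0`, map `S` into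
`S` and satisfy `F_t y - y ∈ K`, and whose time-one map agrees with `Θ` on a neighbourhood of
`0`.  Proof: realise `M_m ∘ ⋯ ∘ M₁ = L` by `exists_ambientIsotopy_realising_linear` and then
`Θ ∘ L⁻¹`, which is tangent to the identity at `0`, by one more cut-off perturbation step at a
smaller radius (Hirsch (1976), Ch. 8 §3, proof of Thm. 3.1). [cite: HirschDT1976, Ch. 8 §3, proof of Thm. 3.1] -/
theorem exists_ambientIsotopy_realising_germ (E : Type*) [NormedAddCommGroup E]
    [NormedSpace ℝ E] [FiniteDimensional ℝ E] [CompleteSpace E] :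
    ∃ ε₀ ∈ Ioc (0 : ℝ) 1, ∀ (S K : Submodule ℝ E) (Θ : E → E) (O : Set E)
      (Ms : List (E ≃L[ℝ] E)) (ρ : ℝ), IsOpen O → (0 : E) ∈ O → ContDiffOn ℝ ∞ Θ O → Θ 0 = 0 →
      (∀ y ∈ O, y ∈ S → Θ y ∈ S) → (∀ y ∈ O, Θ y - y ∈ K) →
      (∀ M ∈ Ms, ‖(M : E →L[ℝ] E) - 1‖ ≤ ε₀) → (∀ M ∈ Ms, ∀ y ∈ S, M y ∈ S) →
      (∀ M ∈ Ms, ∀ y, M y - y ∈ K) →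
      HasFDerivAt Θ ((Ms.prod : E ≃L[ℝ] E) : E →L[ℝ] E) 0 → 0 < ρ →
      ∃ F : AmbientIsotopy 𝓘(ℝ, E) E,
        (∀ t y, ρ ≤ ‖y‖ → F.toFun t y = y) ∧ (∀ᶠ y in 𝓝 0, F.toFun 1 y = Θ y) ∧
        (∀ t, ∀ y ∈ S, F.toFun t y ∈ S) ∧ (∀ t y, F.toFun t y - y ∈ K) ∧
        (∀ t, F.toFun t 0 = 0) := by
  obtain ⟨ε₀, hε₀, H⟩ := exists_perturbation_smul_of_norm_fderiv_le E
  obtain ⟨ε₁, hε₁, HL⟩ := exists_ambientIsotopy_realising_linear E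
  refine ⟨min ε₀ ε₁, ⟨lt_min hε₀ hε₁.1, (min_le_right _ _).trans hε₁.2⟩, ?_⟩
  intro S K Θ O Ms ρ hO h0 hΘ hΘ0 hΘS hΘK hM hMS hMK hD hρ
  set L : E ≃L[ℝ] E := Ms.prod with hL
  -- the linear part
  have hmem : ∀ N ∈ Ms.map ContinuousLinearEquiv.toContinuousLinearMap,
      ∃ M ∈ Ms, (M : E →L[ℝ] E) = N := fun N hN => by
    obtain ⟨M, hM', rfl⟩ := List.mem_map.1 hN
    exact ⟨M, hM', rfl⟩
  obtain ⟨F, hFsupp, hF1, hFS, hFK, hF0⟩ := HL S K (Ms.map ContinuousLinearEquiv.toContinuousLinearMap)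
    (ρ / 2) (by positivity)
    (fun N hN => by
      obtain ⟨M, hM', rfl⟩ := hmem N hN
      exact (hM M hM').trans (min_le_right _ _))
    (fun N hN => by
      obtain ⟨M, hM', rfl⟩ := hmem N hN
      exact hMS M hM')
    (fun N hN => by
      obtain ⟨M, hM', rfl⟩ := hmem N hN
      exact hMK M hM')
  -- the nonlinear part `N = Θ ∘ L⁻¹`, tangent to the identity at `0`
  set O' : Set E := L.symm ⁻¹' O with hO'
  have hO'o : IsOpen O' := hO.preimage L.symm.continuous
  have h0' : (0 : E) ∈ O' := by simp [hO', h0]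
  set N : E → E := fun y => Θ (L.symm y) with hN
  have hNs : ContDiffOn ℝ ∞ N O' := hΘ.comp L.symm.contDiff.contDiffOn fun y hy => hy
  have hN0 : N 0 = 0 := by simp [hN, hΘ0]
  have hDN : HasFDerivAt N (ContinuousLinearMap.id ℝ E) 0 := by
    have h1 : HasFDerivAt Θ ((L : E ≃L[ℝ] E) : E →L[ℝ] E) (L.symm 0) := by
      rw [map_zero]; exact hD
    have h2 := h1.comp (0 : E) L.symm.hasFDerivAt
    rwa [ContinuousLinearEquiv.coe_comp_coe_symm] at h2
  set g : E → E := fun y => N y - y with hg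
  have hgs : ContDiffOn ℝ ∞ g O' := hNs.sub contDiffOn_id
  have hg0 : g 0 = 0 := by simp [hg, hN0]
  have hgd : ∀ z ∈ O', fderiv ℝ g z = fderiv ℝ N z - ContinuousLinearMap.id ℝ E := by
    intro z hz
    have hNz : DifferentiableAt ℝ N z :=
      (hNs.contDiffAt (hO'o.mem_nhds hz)).differentiableAt (by simp)
    exact (hNz.hasFDerivAt.sub (hasFDerivAt_id z)).fderiv
  -- a radius `r` with `B̄(0, 2r) ⊆ O'`, `2r ≤ ρ / 2` and `‖Dg‖ ≤ ε₀` on `B̄(0, 2r)`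
  have hcont : ContinuousAt (fderiv ℝ N) 0 :=
    (hNs.continuousOn_fderiv_of_isOpen hO'o (by simp)).continuousAt (hO'o.mem_nhds h0')
  obtain ⟨δ, hδ, hδO, hδb⟩ : ∃ δ > (0 : ℝ), ball (0 : E) δ ⊆ O' ∧
      ∀ z ∈ ball (0 : E) δ, ‖fderiv ℝ N z - ContinuousLinearMap.id ℝ E‖ ≤ ε₀ := by
    have h1 : ∀ᶠ z in 𝓝 (0 : E), ‖fderiv ℝ N z - ContinuousLinearMap.id ℝ E‖ ≤ ε₀ := by
      have := (Metric.tendsto_nhds.mp hcont) ε₀ hε₀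
      filter_upwards [this] with z hz
      rw [hDN.fderiv, dist_eq_norm] at hz
      exact hz.le
    obtain ⟨δ, hδ, hδb⟩ := Metric.eventually_nhds_iff_ball.mp (h1.and (hO'o.mem_nhds h0'))
    exact ⟨δ, hδ, fun z hz => (hδb z hz).2, fun z hz => (hδb z hz).1⟩
  set r : ℝ := min (δ / 3) (ρ / 4) with hr
  have hr0 : 0 < r := by positivity
  have hrδ : 2 * r < δ := by
    have : r ≤ δ / 3 := min_le_left _ _
    linarith
  have hrρ : 2 * r ≤ ρ / 2 := by
    have : r ≤ ρ / 4 := min_le_right _ _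
    linarith
  have hBO : closedBall (0 : E) (2 * r) ⊆ ball (0 : E) δ := closedBall_subset_ball hrδ
  obtain ⟨p, hp, hb, hpg, hp0, hsmul⟩ := H r hr0 g O' hO'o (hBO.trans hδO) hgs hg0
    (fun z hz => by rw [hgd z (hδO (hBO hz))]; exact hδb z (hBO hz))
  obtain ⟨G, hGsupp, hG1, hGS, hGK, hG0⟩ := exists_ambientIsotopy_step hp hb hpg hp0 hsmul hg0
  -- structural properties of `g` near `0`
  have hgS : ∀ y ∈ O', y ∈ S → g y ∈ S := by
    intro y hy hyS
    have h1 : L.symm y ∈ S := list_prod_symm_apply_mem Ms hMS hyS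
    exact S.sub_mem (hΘS _ hy h1) hyS
  have hgK : ∀ y ∈ O', g y ∈ K := by
    intro y hy
    have h1 : L.symm y - y ∈ K := list_prod_symm_apply_sub_mem Ms hMK y
    have h2 : Θ (L.symm y) - L.symm y ∈ K := hΘK _ hy
    have : g y = (Θ (L.symm y) - L.symm y) + (L.symm y - y) := by simp only [hg, hN]; abel
    rw [this]
    exact K.add_mem h2 h1
  -- outside `O'` the perturbation vanishes, so the structural properties hold everywhere
  have hgS' : ∀ t y, y ∈ S → G.toFun t y ∈ S := by
    intro t y hyS
    by_cases hy : y ∈ closedBall (0 : E) (2 * r)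
    · exact hGS S t y hyS (hgS y (hδO (hBO hy)) hyS)
    · rw [hGsupp t y (by simpa using (not_le.1 (by simpa using hy)).le)]
      exact hyS
  have hgK' : ∀ t y, G.toFun t y - y ∈ K := by
    intro t y
    by_cases hy : y ∈ closedBall (0 : E) (2 * r)
    · exact hGK K t y (hgK y (hδO (hBO hy)))
    · rw [hGsupp t y (by simpa using (not_le.1 (by simpa using hy)).le), sub_self]
      exact K.zero_mem
  refine ⟨F.comp G, fun t y hy => ?_, ?_, fun t y hy => ?_, fun t y => ?_, fun t => ?_⟩
  · -- support
    rw [AmbientIsotopy.comp_toFun, comp_apply, hFsupp t y (by linarith),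
      hGsupp t y (by linarith)]
  · -- the time-one map near `0`
    have hm : (Ms.map ContinuousLinearEquiv.toContinuousLinearMap).length = Ms.length :=
      List.length_map _
    set δ₁ : ℝ := min (ρ / 2 / 2 ^ Ms.length) (r / 2 ^ Ms.length) with hδ₁
    have hδ₁0 : 0 < δ₁ := by positivity
    filter_upwards [Metric.closedBall_mem_nhds (0 : E) hδ₁0] with y hy
    have hy' : ‖y‖ ≤ δ₁ := by simpa using hy
    have hy1 : ‖y‖ ≤ ρ / 2 / 2 ^ (Ms.map ContinuousLinearEquiv.toContinuousLinearMap).length := by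
      rw [hm]; exact hy'.trans (min_le_left _ _)
    have hM2 : ∀ N ∈ (Ms.map ContinuousLinearEquiv.toContinuousLinearMap), ‖N‖ ≤ 2 := by
      intro N hN'
      obtain ⟨M, hMm, rfl⟩ := hmem N hN'
      have h1 : ‖(M : E →L[ℝ] E) - 1‖ ≤ 1 :=
        (hM M hMm).trans ((min_le_right _ _).trans hε₁.2)
      calc ‖(M : E →L[ℝ] E)‖ = ‖((M : E →L[ℝ] E) - 1) + 1‖ := by rw [sub_add_cancel]
        _ ≤ ‖(M : E →L[ℝ] E) - 1‖ + ‖(1 : E →L[ℝ] E)‖ := norm_add_le _ _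
        _ ≤ 1 + 1 := add_le_add h1 ContinuousLinearMap.norm_id_le
        _ = 2 := by norm_num
    have hLy : ‖L y‖ ≤ r := by
      have h1 := norm_list_prod_apply_le hM2 y
      rw [← coe_list_prod, hm] at h1
      calc ‖L y‖ ≤ 2 ^ Ms.length * ‖y‖ := h1
        _ ≤ 2 ^ Ms.length * (r / 2 ^ Ms.length) := by
            gcongr; exact hy'.trans (min_le_right _ _)
        _ = r := by field_simp
    rw [AmbientIsotopy.comp_toFun, comp_apply, hF1 y hy1, ← coe_list_prod]
    change G.toFun 1 (L y) = Θ y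
    rw [hG1 _ hLy]
    simp only [hg, hN, ContinuousLinearEquiv.symm_apply_apply, add_sub_cancel]
  · rw [AmbientIsotopy.comp_toFun, comp_apply]
    exact hgS' t _ (hFS t y hy)
  · rw [AmbientIsotopy.comp_toFun, comp_apply]
    have : G.toFun t (F.toFun t y) - y = (G.toFun t (F.toFun t y) - F.toFun t y) +
        (F.toFun t y - y) := by abel
    rw [this]
    exact K.add_mem (hgK' t _) (hFK t y)
  · rw [AmbientIsotopy.comp_toFun, comp_apply, hF0 t, hG0 t]

end Germ

end Literature.Topology.FourManifolds
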